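import Summits.Ventures.Crystal3D.Theorems.StickyWulffConstantCoaxialWallLawTailResidueDefsT5
import Summits.Ventures.Crystal3D.Theorems.StickyWulffConstantCoaxialWallLawTailResidueClosingM
import Summits.Ventures.Crystal3D.Theorems.StickyWulffConstantCoaxialWallLawPayerPoolBound
import HarnessLib

/-!
# The lane-F closing theorem on the DEGREE-SPLIT T5: `… → MultiGrainSmallLow (2√6) 3 → (KissingGap → KissingClassification → MultiGrainSmallHigh (2√6) 3)
# → CoaxialWallLaw`, with the low half DISCHARGED (crux `CoaxialWallLaw`, stmt-Ventures-19481; cf-p1 DECISION (clxxxii); definitions `…TailResidueDefsT5`)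

HONEST FRAMING. Venture `Summits/Ventures/Crystal3D` (cell `crystal3d-full`); helper `--supports` the crux `CoaxialWallLaw` (stmt-Ventures-19481,
`route-Ventures-StickyWulffConstant`), registered line 'CoaxialWallLawCertificates' (planner cf-p1; v4 registers on this file).  Rung credit; F-C1 NOT moved.
`…TailResidueClosingM` (p705688) closed the crux by name on `LensCert (2√6) ∧ MonoCapture ∧ ModuleCapture ∧ MultiGrainSmall (2√6)`; (clxxxii) re-cut the
last binder by the payer's degree (`…TailResidueDefsT5`): the LOW half (`deg z ≤ 3`) is the census-free payer-pool bound of `…PayerPoolBound`, the HIGH half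
(`deg z ≥ 4`: jammed dust next to a crystallite, second-generation twins) is the one open T5 stub, typed under the kissing facts already bound by the cone.
* **`TailResidue.multiGrainSmallLow_three : MultiGrainSmallLow (2√6) 3`** — by `multiGrainSmall_of_degree_le_three` (no off-site / mono-module
  hypothesis is even used);
* **`coaxialWallLaw_of_lensCertificates_split`** — the v3 cone with `MultiGrainSmall (2√6)` replaced by the pair
  `MultiGrainSmallLow (2√6) 3`, `KissingGap (5/2) → KissingClassification (5/2) → MultiGrainSmallHigh (2√6) 3` (the composition of record for
  'Certificates' v4: stubs `stub_multiGrainSmallLow`, `stub_multiGrainSmallHigh`);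
* `coaxialWallLaw_of_lensCertificates_high_explicit` — the same with the low half discharged (ten binders).
REMAINING BY-NAME DEBTS: `P5Exhaustion`; the two on-site flats; `LensCert (2√6)`; `ModuleCapture` [proved: `…TailResidueModuleCapture`, landing];
`MultiGrainSmallHigh (2√6) 3` under the kissing facts [OPEN; F-TAIL-g10 §9].  WHAT THIS IS NOT: not those; F-C1 not moved.
-/

noncomputable section

namespace Summit.Ventures.Crystal3D.Theorems

open Summit.Ventures.Crystal3D Finset TailResidue
open scoped InnerProductSpace

namespace TailResidue

/-- **THE LOW HALF OF T5 IS CENSUS-FREE**: `MultiGrainSmallLow (2√6) 3` — at a payer touching at most three balls the joint (A)-summand is `≤ 13/3 < 2√6`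
for every frame and every window (`multiGrainSmall_of_degree_le_three`). -/
theorem multiGrainSmallLow_three : MultiGrainSmallLow (2 * Real.sqrt 6) 3 :=
  fun L X hX z hz _ _ _ hk => Or.inr (multiGrainSmall_of_degree_le_three L X hX z hz hk)

end TailResidue

/-- **THE LANE-F CONE ON THE DEGREE-SPLIT T5** (composition of record for 'Certificates' v4): the v3 cone `coaxialWallLaw_of_lensCertificates_mono_explicit`
with its binder `MultiGrainSmall (2√6)` re-assembled from `MultiGrainSmallLow (2√6) 3` and `KissingGap (5/2) → KissingClassification (5/2) →
MultiGrainSmallHigh (2√6) 3` (the kissing facts are threaded from the cone's own binders). -/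
theorem coaxialWallLaw_of_lensCertificates_split (hg : KissingGap (5 / 2)) (hc : KissingClassification (5 / 2))
    (hSP : StarPairFar) (hE1 : P5Exhaustion) (honT : EndRowOnSiteFlatA WordVersion.v2 (9 / 2) coaxialModuleUniverse)
    (honJ : EndRowOnSiteJointFlatA WordVersion.v2 (2 * Real.sqrt 6) coaxialModuleUniverse)
    (hcert : LensCert (2 * Real.sqrt 6)) (hmono : MonoCapture) (hmod : ModuleCapture)
    (hlow : MultiGrainSmallLow (2 * Real.sqrt 6) 3)
    (hhigh : KissingGap (5 / 2) → KissingClassification (5 / 2) → MultiGrainSmallHigh (2 * Real.sqrt 6) 3) :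
    Summit.Ventures.Crystal3D.Theses.StickyWulffConstant.CoaxialWallLaw :=
  coaxialWallLaw_of_lensCertificates_mono_explicit hg hc hSP hE1 honT honJ hcert hmono hmod
    (multiGrainSmall_of_low_of_high hlow (hhigh hg hc))

/-- **The cone with the low half discharged** (ten binders): `… → ModuleCapture → (KissingGap (5/2) → KissingClassification (5/2) →
MultiGrainSmallHigh (2√6) 3) → CoaxialWallLaw`. -/
theorem coaxialWallLaw_of_lensCertificates_high_explicit (hg : KissingGap (5 / 2)) (hc : KissingClassification (5 / 2))
    (hSP : StarPairFar) (hE1 : P5Exhaustion) (honT : EndRowOnSiteFlatA WordVersion.v2 (9 / 2) coaxialModuleUniverse)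
    (honJ : EndRowOnSiteJointFlatA WordVersion.v2 (2 * Real.sqrt 6) coaxialModuleUniverse)
    (hcert : LensCert (2 * Real.sqrt 6)) (hmono : MonoCapture) (hmod : ModuleCapture)
    (hhigh : KissingGap (5 / 2) → KissingClassification (5 / 2) → MultiGrainSmallHigh (2 * Real.sqrt 6) 3) :
    Summit.Ventures.Crystal3D.Theses.StickyWulffConstant.CoaxialWallLaw :=
  coaxialWallLaw_of_lensCertificates_split hg hc hSP hE1 honT honJ hcert hmono hmod multiGrainSmallLow_three hhigh

end Summit.Ventures.Crystal3D.Theorems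

end
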